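import Mathlib
import Literature.Analysis.FluidPDE.VorticityStretching
import Literature.Analysis.FluidPDE.AncientSimilarityVorticity
import Literature.Analysis.FluidPDE.WholeSpaceIBP
import HarnessLib

/-!
# Route `EfficiencyFloor`, crux `MaximiserSetRigidity` (stmt-NavierStokesRegularity-25512), part (b):
# the VORTICITY FORM of the relative-equilibrium profile equation (pointwise; the pressure drops out)

Helper file (`--supports stmt-NavierStokesRegularity-25512 --as helper`; route-independent imports). First brick of the
analytic half (EB) typed in `…MaximiserSetRigidityEnstrophyBalance` / `…PartBReduction` (p820129 / p820369): the item's
relative-equilibrium equation `νΔm − (m·∇)m − ∇π = (a·∇)m + ((Wx)·∇)m − Wm + c′(m + (x·∇)m)` (`W` skew-adjoint), after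
taking the curl, becomes the pressure-free vorticity equation

  `νΔω − ((m·∇)ω − (ω·∇)m) = (a·∇)ω + ((Wx)·∇)ω − Wω + c′(2ω + (x·∇)ω)`,  `ω = curl m`        (`vorticity_form`),

for `m ∈ C³` divergence-free and `π ∈ C²`. Ingredients: the tree's `curl_laplacian`, `curl_convect_self_of_isDivFree`,
`curl_gradient_eq_zero_holds`, `curl_fderiv_apply` (constant directions), `curl_fderiv_apply_self` (`curl((x·∇)m) = ω + (x·∇)ω`)
and two new pieces:

* `curlCLM_comm_skew` — for linear `M` and skew-adjoint `W` on `EuclideanSpace ℝ (Fin 3)`: `curlCLM (M∘W − W∘M) = −W(curlCLM M)` (coordinates);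
* `curl_rotation_term` — `curl (y ↦ Dm(y)[Wy] − W m(y)) = D(curl m)[Wx] − W(curl m)`: the curl commutes with the
  generator of rotations (product rule, Schwarz symmetry, `curlCLM_comm_skew`).

What remains of (EB): test `vorticity_form` against `ω` with the radial cut-offs of `WholeSpaceIBPIntegrable` and pass to the
limit (`∫⟨Δω,ω⟩χ_R → −Pal`, transport terms `→ 0`, `∫⟨(x·∇)ω,ω⟩χ_R → −(3/2)Z`). HONEST FRAMING: pointwise vector calculus;
(EB), stmt-25512, `LerayFloorGap`, `ProductionEfficiencyDecay` and Navier–Stokes regularity stay OPEN; no summit statement is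
proved. [folklore]
-/

noncomputable section

-- the problem directory repeats the summit name (`NavierStokesRegularity/NavierStokesRegularity`)
set_option linter.dupNamespace false

namespace Summit.NavierStokesRegularity.NavierStokesRegularity.Theorems

namespace MaximiserSetRigidity

namespace ProfileVorticity

open Literature.Analysis Literature.Analysis.FluidPDE
open scoped InnerProductSpace Laplacian ContDiff


/-- **Curl of a skew commutator of Jacobians.** For linear maps `M, W` on `EuclideanSpace ℝ (Fin 3)` with `W` skew-adjoint,
`curlCLM (M ∘ W − W ∘ M) = −W (curlCLM M)`: the algebra of `curl(((Wx)·∇)v − Wv) = ((Wx)·∇)ω − Wω`. [folklore] -/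
theorem curlCLM_comm_skew (M W : EuclideanSpace ℝ (Fin 3) →L[ℝ] EuclideanSpace ℝ (Fin 3)) (hW : ∀ x y : EuclideanSpace ℝ (Fin 3), ⟪W x, y⟫_ℝ = -⟪x, W y⟫_ℝ) :
    curlCLM (M.comp W - W.comp M) = -(W (curlCLM M)) := by
  have hbasis : ∀ v : EuclideanSpace ℝ (Fin 3), v = ∑ k, v k • EuclideanSpace.single k (1 : ℝ) := fun v => by
    conv_lhs => rw [← (EuclideanSpace.basisFun (Fin 3) ℝ).sum_repr v]
    simp
  have hsk : ∀ i j : Fin 3, W (EuclideanSpace.single j 1) i = -(W (EuclideanSpace.single i 1) j) := by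
    intro i j
    have h := hW (EuclideanSpace.single j 1) (EuclideanSpace.single i 1)
    rw [EuclideanSpace.inner_single_right, EuclideanSpace.inner_single_left] at h
    simpa using h
  have h00 : W (EuclideanSpace.single 0 1) 0 = 0 := by have := hsk 0 0; linarith
  have h11 : W (EuclideanSpace.single 1 1) 1 = 0 := by have := hsk 1 1; linarith
  have h22 : W (EuclideanSpace.single 2 1) 2 = 0 := by have := hsk 2 2; linarith
  have h10 := hsk 0 1
  have h20 := hsk 0 2
  have h21 := hsk 1 2
  have hMW : ∀ j, M (W (EuclideanSpace.single j 1)) =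
      ∑ k, W (EuclideanSpace.single j 1) k • M (EuclideanSpace.single k 1) := by
    intro j
    conv_lhs => rw [hbasis (W (EuclideanSpace.single j 1))]
    simp [map_sum, map_smul]
  have hWM : ∀ j, W (M (EuclideanSpace.single j 1)) =
      ∑ k, M (EuclideanSpace.single j 1) k • W (EuclideanSpace.single k 1) := by
    intro j
    conv_lhs => rw [hbasis (M (EuclideanSpace.single j 1))]
    simp [map_sum, map_smul]
  have hWc : W (curlCLM M) = ∑ k, (curlCLM M) k • W (EuclideanSpace.single k 1) := by
    conv_lhs => rw [hbasis (curlCLM M)]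
    simp [map_sum, map_smul]
  ext i
  rw [hWc]
  fin_cases i <;>
    simp [curlCLM, curlLM, ContinuousLinearMap.comp_apply, hMW, hWM, Fin.sum_univ_three, h00, h11, h22,
      h10, h20, h21] <;> ring

/-- **Curl of the rotation term**: for `v ∈ C²` and `W` skew-adjoint,
`curl (y ↦ Dv(y)[W y] − W v(y)) (x) = D(curl v)(x)[W x] − W (curl v x)`. [folklore] -/
theorem curl_rotation_term {v : EuclideanSpace ℝ (Fin 3) → EuclideanSpace ℝ (Fin 3)} (hv : ContDiff ℝ 2 v) (W : EuclideanSpace ℝ (Fin 3) →L[ℝ] EuclideanSpace ℝ (Fin 3))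
    (hW : ∀ x y : EuclideanSpace ℝ (Fin 3), ⟪W x, y⟫_ℝ = -⟪x, W y⟫_ℝ) (x : EuclideanSpace ℝ (Fin 3)) :
    curl (fun y => fderiv ℝ v y (W y) - W (v y)) x = fderiv ℝ (curl v) x (W x) - W (curl v x) := by
  have hD : DifferentiableAt ℝ (fderiv ℝ v) x :=
    ((hv.fderiv_right (m := 1) (by norm_num)).differentiable one_ne_zero) x
  have hvd : DifferentiableAt ℝ v x := (hv.differentiable (by norm_num)) x
  have h1d : DifferentiableAt ℝ (fun y => fderiv ℝ v y (W y)) x := hD.clm_apply W.differentiableAt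
  have h2d : DifferentiableAt ℝ (fun y => W (v y)) x := W.differentiableAt.comp x hvd
  have h1 : fderiv ℝ (fun y => fderiv ℝ v y (W y)) x =
      (fderiv ℝ v x).comp W + (fderiv ℝ (fderiv ℝ v) x).flip (W x) := by
    rw [fderiv_clm_apply hD W.differentiableAt, ContinuousLinearMap.fderiv]
  have h22 : minSmoothness ℝ 2 ≤ (2 : ℕ∞ω) := by
    rw [minSmoothness_of_isRCLikeNormedField]
  have hS : ∀ a b, fderiv ℝ (fderiv ℝ v) x a b = fderiv ℝ (fderiv ℝ v) x b a := fun a b =>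
    (hv.contDiffAt.isSymmSndFDerivAt h22).eq a b
  have hflip : (fderiv ℝ (fderiv ℝ v) x).flip (W x) = fderiv ℝ (fderiv ℝ v) x (W x) := by
    ext h
    rw [ContinuousLinearMap.flip_apply, hS]
  have h2 : fderiv ℝ (fun y => W (v y)) x = W.comp (fderiv ℝ v x) :=
    (W.hasFDerivAt.comp x hvd.hasFDerivAt).fderiv
  have hc := curlCLM_comm_skew (fderiv ℝ v x) W hW
  rw [map_sub] at hc
  have hX : curlCLM ((fderiv ℝ v x).comp W) = curlCLM (W.comp (fderiv ℝ v x)) - W (curlCLM (fderiv ℝ v x)) := by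
    rw [sub_eq_iff_eq_add] at hc
    rw [hc]
    abel
  rw [curl_sub h1d h2d, curl_eq_curlCLM (fun y => fderiv ℝ v y (W y)), curl_eq_curlCLM (fun y => W (v y)),
    h1, h2, hflip, map_add, fderiv_curl hv x, ContinuousLinearMap.comp_apply, curl_eq_curlCLM v x, hX]
  abel

/-- **The vorticity form of the relative-equilibrium profile equation.** If `m ∈ C³` is divergence-free, `π ∈ C²`,
`W` is skew-adjoint and `νΔm − (m·∇)m − ∇π = (a·∇)m + ((Wx)·∇)m − Wm + c′(m + (x·∇)m)` pointwise, then, with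
`ω = curl m`: `νΔω − ((m·∇)ω − (ω·∇)m) = (a·∇)ω + ((Wx)·∇)ω − Wω + c′(2ω + (x·∇)ω)` pointwise. [folklore] -/
theorem vorticity_form {ν c' : ℝ} {a : EuclideanSpace ℝ (Fin 3)} {W : EuclideanSpace ℝ (Fin 3) →L[ℝ] EuclideanSpace ℝ (Fin 3)} {m : EuclideanSpace ℝ (Fin 3) → EuclideanSpace ℝ (Fin 3)} {π : EuclideanSpace ℝ (Fin 3) → ℝ}
    (hm : ContDiff ℝ 3 m) (hdiv : VectorCalculus.IsDivFree m) (hπ : ContDiff ℝ 2 π)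
    (hW : ∀ x y : EuclideanSpace ℝ (Fin 3), ⟪W x, y⟫_ℝ = -⟪x, W y⟫_ℝ)
    (heq : ∀ x : EuclideanSpace ℝ (Fin 3), ν • Δ m x - convect m m x - gradient π x =
      fderiv ℝ m x a + (fderiv ℝ m x (W x) - W (m x)) + c' • (m x + fderiv ℝ m x x)) (x : EuclideanSpace ℝ (Fin 3)) :
    ν • Δ (curl m) x - (convect m (curl m) x - convect (curl m) m x) =
      fderiv ℝ (curl m) x a + (fderiv ℝ (curl m) x (W x) - W (curl m x)) +
        c' • (2 • curl m x + fderiv ℝ (curl m) x x) := by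
  have hm2 : ContDiff ℝ 2 m := hm.of_le (by norm_cast)
  have hmd : DifferentiableAt ℝ m x := (hm.differentiable (by norm_num)) x
  have hD : DifferentiableAt ℝ (fderiv ℝ m) x :=
    ((hm.fderiv_right (m := 2) (by norm_cast)).differentiable (by norm_num)) x
  -- differentiability of the Laplacian (as in `curl_laplacian`)
  set b := stdOrthonormalBasis ℝ (EuclideanSpace ℝ (Fin 3))
  have hd1 : ∀ e, ContDiff ℝ 2 fun y => fderiv ℝ m y e := fun e =>
    (hm.fderiv_right (m := 2) (by norm_cast)).clm_apply contDiff_const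
  have hd2 : ∀ e e', ContDiff ℝ 1 fun y => fderiv ℝ (fun z => fderiv ℝ m z e) y e' := fun e e' =>
    ((hd1 e).fderiv_right (m := 1) (by norm_cast)).clm_apply contDiff_const
  have hΔeq : Δ m = fun y => ∑ i, fderiv ℝ (fun z => fderiv ℝ m z (b i)) y (b i) :=
    funext fun y => laplacian_eq_sum_fderiv_fderiv b hm2 y
  have hΔd : DifferentiableAt ℝ (Δ m) x := by
    rw [hΔeq]
    exact DifferentiableAt.fun_sum fun i _ => ((hd2 (b i) (b i)).differentiable one_ne_zero) x
  have hΔν : DifferentiableAt ℝ (fun y => ν • Δ m y) x := hΔd.const_smul ν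
  have hconv : DifferentiableAt ℝ (convect m m) x := by
    show DifferentiableAt ℝ (fun y => fderiv ℝ m y (m y)) x
    exact hD.clm_apply hmd
  have hgrad : DifferentiableAt ℝ (gradient π) x := by
    show DifferentiableAt ℝ (fun y => (InnerProductSpace.toDual ℝ (EuclideanSpace ℝ (Fin 3))).symm (fderiv ℝ π y)) x
    exact ((InnerProductSpace.toDual ℝ (EuclideanSpace ℝ (Fin 3))).symm.differentiable.comp
      ((hπ.fderiv_right (m := 1) (by norm_num)).differentiable one_ne_zero)).differentiableAt
  have ha : DifferentiableAt ℝ (fun y => fderiv ℝ m y a) x := hD.clm_apply (differentiableAt_const a)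
  have hrot : DifferentiableAt ℝ (fun y => fderiv ℝ m y (W y) - W (m y)) x :=
    (hD.clm_apply W.differentiableAt).sub (W.differentiableAt.comp x hmd)
  have hself : DifferentiableAt ℝ (fun y => m y + fderiv ℝ m y y) x := hmd.add (hD.clm_apply differentiableAt_id)
  -- curl of both sides
  have hfun : (fun y => ν • Δ m y - convect m m y - gradient π y) =
      (fun y => fderiv ℝ m y a + (fderiv ℝ m y (W y) - W (m y)) + c' • (m y + fderiv ℝ m y y)) := funext heq
  have hcurl : curl (fun y => ν • Δ m y - convect m m y - gradient π y) x =
      curl (fun y => fderiv ℝ m y a + (fderiv ℝ m y (W y) - W (m y)) + c' • (m y + fderiv ℝ m y y)) x := by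
    rw [hfun]
  -- left-hand side, term by term (explicit instances of the pointwise curl rules)
  have e1 : curl (fun y => ν • Δ m y - convect m m y - gradient π y) x =
      curl (fun y => ν • Δ m y - convect m m y) x - curl (gradient π) x :=
    curl_sub (f := fun y => ν • Δ m y - convect m m y) (g := gradient π) (hΔν.sub hconv) hgrad
  have e2 : curl (fun y => ν • Δ m y - convect m m y) x = curl (fun y => ν • Δ m y) x - curl (convect m m) x :=
    curl_sub (f := fun y => ν • Δ m y) (g := convect m m) hΔν hconv
  have e3 : curl (fun y => ν • Δ m y) x = ν • curl (Δ m) x := curl_const_smul (f := Δ m) hΔd ν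
  have e4 : curl (Δ m) x = Δ (curl m) x := curl_laplacian hm x
  have e5 : curl (convect m m) x = convect m (curl m) x - convect (curl m) m x :=
    curl_convect_self_of_isDivFree hm2 hdiv x
  have e6 : curl (gradient π) x = 0 := curl_gradient_eq_zero_holds π hπ x
  -- right-hand side
  have f1 : curl (fun y => fderiv ℝ m y a + (fderiv ℝ m y (W y) - W (m y)) + c' • (m y + fderiv ℝ m y y)) x =
      curl (fun y => fderiv ℝ m y a + (fderiv ℝ m y (W y) - W (m y))) x +
        curl (fun y => c' • (m y + fderiv ℝ m y y)) x :=
    curl_add (f := fun y => fderiv ℝ m y a + (fderiv ℝ m y (W y) - W (m y)))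
      (g := fun y => c' • (m y + fderiv ℝ m y y)) (ha.add hrot) (hself.const_smul c')
  have f2 : curl (fun y => fderiv ℝ m y a + (fderiv ℝ m y (W y) - W (m y))) x =
      curl (fun y => fderiv ℝ m y a) x + curl (fun y => fderiv ℝ m y (W y) - W (m y)) x :=
    curl_add (f := fun y => fderiv ℝ m y a) (g := fun y => fderiv ℝ m y (W y) - W (m y)) ha hrot
  have f3 : curl (fun y => fderiv ℝ m y a) x = fderiv ℝ (curl m) x a := curl_fderiv_apply hm2 x a
  have f4 := curl_rotation_term hm2 W hW x
  have f5 : curl (fun y => c' • (m y + fderiv ℝ m y y)) x = c' • curl (fun y => m y + fderiv ℝ m y y) x :=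
    curl_const_smul (f := fun y => m y + fderiv ℝ m y y) hself c'
  have f6 : curl (fun y => m y + fderiv ℝ m y y) x = curl m x + curl (fun y => fderiv ℝ m y y) x :=
    curl_add (f := m) (g := fun y => fderiv ℝ m y y) hmd (hD.clm_apply differentiableAt_id)
  have f7 : curl (fun y => fderiv ℝ m y y) x = curl m x + fderiv ℝ (curl m) x x := curl_fderiv_apply_self hm2 x
  rw [e1, e2, e3, e4, e5, e6, sub_zero, f1, f2, f3, f4, f5, f6, f7] at hcurl
  rw [hcurl]
  simp only [two_smul, smul_add]
  abel

end ProfileVorticity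

end MaximiserSetRigidity

end Summit.NavierStokesRegularity.NavierStokesRegularity.Theorems

end
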